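import Literature.MathematicalPhysics.QuantumFieldTheory.Balaban1983to89.B10Eq27TorusAxialLog
import Literature.MathematicalPhysics.QuantumFieldTheory.Balaban1983to89.BlockAveragingFederbush
import Summits.QuantumFields.YangMills.Theorems.UnitScaleTiltFluctuationComparisonRegPrGlobalSlackLegCfgDistT3
import HarnessLib

/-!
# `UnitScaleTiltFluctuationComparisonRegPrGlobalSlackLegCfgLipschitzT3` — THE (27) LOOP VARIABLES ARE LIPSCHITZ IN THE GAUGE FIELD WITH CONSTANT LINEAR IN THE LEG DISTANCE:
# the located origin of the `(1 + d(c))` weight of (44) / (R5) / `CfgDistCauchyΦ` (crux `FluctuationComparisonRegPrIntL`, stmt-QuantumFields-20520, skeleton v5kC, STUB 3⁗χ;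
# cell `pub/ym-inputs`, seat ym-inputs-p12 = INPUT-LIST I-11 row `CfgDistCauchyΦ`; count-neutral helper, registry untouched)

WHY.  The loop-variable rows of 3⁗χ ((44) `CfgDistΦ`, (R5) `CfgRefOwnΦ`, the I-11 row `CfgDistCauchyΦ`) carry, leg by leg, the weight `1 + d(c)` — print's
`(Lʲη)⁻¹|c₋ − y|` of (44) p.267.  For the NATURAL configuration family (the (27) axial-gauge loop variables `B27T V y c = (1/i) log V(Γ_{y,c₋} ∪ c ∪ Γ_{c₊,y})` of
[Balaban1985UV3] (27) p.263, tree `B10Eq27TorusAxialLog.B27T`, read at the (averaged) minimiser — sibling seat p11's (44) file) that weight IS the Lipschitz constant of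
`V ↦ B27T V y c`: the contour `Γ_{y,c₋} ∪ c ∪ Γ_{c₊,y}` has `2|c₋ − y|₁ + 2` bonds, parallel transport is `1`-Lipschitz in each bond variable, and the series logarithm is
`(1 − ρ)⁻¹`-Lipschitz on `‖· − 1‖ ≤ ρ`.  So the displays (Lip)/(C) of the fixed-point / fine-comparison reductions (`…KernelLegCfgFixedPoint*`, same seat) hold for this family
with exactly the row's weight — typed here as theorems about gauge fields, no (α) package involved.

* §1 **`norm_holT_sub_holT_le`** — for `𝔸ˣ`-valued torus configurations in the norm-one ball `U1 𝔸` ([Balaban1985Averaging] (9)): `‖V(Γ) − V′(Γ)‖ ≤ |Γ|·ε` whenever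
  `‖V(b) − V′(b)‖ ≤ ε` and `‖V(b)⁻¹ − V′(b)⁻¹‖ ≤ ε` on every bond (telescoping; `norm_val_holT_le_one`).
* §2 **`length_contourT`** (`= |c₋ − y|₁ + 1 + |c₊ − y|₁`), **`length_contourT_le`** (`≤ 2|c₋ − y|₁ + 2`), ★ **`norm_B27T_sub_B27T_le`**: if both contour holonomies are within
  `ρ < 1` of `1`, `‖B27T V y c − B27T V′ y c‖ ≤ (1 − ρ)⁻¹·|Γ|·ε ≤ (1 − ρ)⁻¹·(2|c₋ − y|₁ + 2)·ε` (`FederbushMean.norm_mlog_sub_mlog_sub_le`).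
* §3 the `SU(N)` reading through `unitsField ∘ toUField` (inverse = adjoint, ONE `ε`): **`norm_B27T_su_sub_le`**.
* §4 the bridge to the canonical leg distance of `…KernelLegGeometry` (sibling seat p11's `cast_l1_rel_eq_pdist`: `|c₋ − y|₁ = pdist c₋ y`): ★ **`norm_B27T_su_sub_le_canonLegDist`**:
  at an anchor `y` attaining `canonLegDist F K b Y c`, `‖ΔB(c)‖ ≤ 2(1 − ρ)⁻¹·(1 + canonLegDist F K b Y c)·ε`.
HONEST FRAMING.  Elementary normed-ring estimates over the tree's (27) objects; nothing of [Balaban1985UV3] / [Balaban1985Averaging] is asserted beyond the cited shapes; not a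
discharge of any row (the minimiser and its two-cut-off comparison are not here); no summit / rung / gap claim (YM₃ on T³ is rung R3, not the Clay problem).

References: T. Bałaban, CMP 102 (1985) 255–275 [Balaban1985UV3] ((27)–(28) p.263, (43)–(45) pp.266–267); CMP 98 (1985) 17–51 [Balaban1985Averaging] ((9) p.18, p.24–25);
C. King, CMP 102 (1986) 649–677 [King1986] (Prop. 3.9 (3.71)–(3.74) p.665).
-/

set_option autoImplicit false

noncomputable section

open scoped BigOperators
open Literature.MathematicalPhysics.QuantumFieldTheory.Balaban1983to89
open Literature.MathematicalPhysics.QuantumFieldTheory.Balaban1983to89.B10Eq27TorusAxialLog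
open Literature.MathematicalPhysics.QuantumFieldTheory.Balaban1983to89.T3ContinuumYM3Torus (T3Family)
open Literature.MathematicalPhysics.QuantumFieldTheory.Balaban1983to89.B7Prop1Explicit (Letter e treeWord revWord l1 U1 mem_U1 length_treeWord length_revWord l1_add_le l1_vec)
open Literature.MathematicalPhysics.QuantumFieldTheory.Balaban1983to89.B7Prop2Explicit (unitaryUnits mem_unitaryUnits unitaryUnits_le_U1 hol_mem_of)
open Literature.MathematicalPhysics.QuantumFieldTheory.Balaban1983to89.MatrixLog (mlog)
open Literature.MathematicalPhysics.QuantumFieldTheory.Balaban1983to89.FederbushMean (norm_mlog_sub_mlog_sub_le)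

namespace Summit.QuantumFields.YangMills.Theorems.GlobalSlackKernelLeg

/-! ## §1 Parallel transport is `1`-Lipschitz in each bond variable -/

section Transport

variable {𝔸 : Type*} [NormedRing 𝔸] [NormOneClass 𝔸] {P : Params} {j : ℕ}

/-- Transports of a `U1`-valued configuration have norm `≤ 1`. [cite: Balaban1985Averaging, (9) p.18] -/
theorem norm_val_holT_le_one {V : GaugeField P j 𝔸ˣ} (hV : ∀ b, V b ∈ U1 𝔸) (x : Site P j) (w : List (Letter P.d)) :
    ‖((holT V x w : 𝔸ˣ) : 𝔸)‖ ≤ 1 := by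
  have h : holT V x w ∈ U1 𝔸 := by
    rw [← hol_pull_zero]
    exact hol_mem_of (V := pull V x) (fun _ _ => hV _) 0 w
  exact (mem_U1.mp h).1

omit [NormOneClass 𝔸] in
/-- One telescoping step: `‖ah − a′h′‖ ≤ ε + δ` when `‖a − a′‖ ≤ ε`, `‖a′‖ ≤ 1`, `‖h‖ ≤ 1`, `‖h − h′‖ ≤ δ` (`ah − a′h′ = (a − a′)h + a′(h − h′)`). [folklore] -/
theorem norm_mul_sub_mul_le_add {a a' h h' : 𝔸} {ε δ : ℝ} (ha : ‖a - a'‖ ≤ ε) (ha' : ‖a'‖ ≤ 1) (hh : ‖h‖ ≤ 1) (hhh : ‖h - h'‖ ≤ δ) :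
    ‖a * h - a' * h'‖ ≤ ε + δ := by
  have e1 : a * h - a' * h' = (a - a') * h + a' * (h - h') := by noncomm_ring
  rw [e1]
  calc ‖(a - a') * h + a' * (h - h')‖ ≤ ‖a - a'‖ * ‖h‖ + ‖a'‖ * ‖h - h'‖ := norm_add_le_of_le (norm_mul_le _ _) (norm_mul_le _ _)
    _ ≤ ‖a - a'‖ * 1 + 1 * ‖h - h'‖ :=
        add_le_add (mul_le_mul_of_nonneg_left hh (norm_nonneg _)) (mul_le_mul_of_nonneg_right ha' (norm_nonneg _))
    _ ≤ ε + δ := by linarith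

/-- **PARALLEL TRANSPORT IS `1`-LIPSCHITZ IN EACH BOND VARIABLE**: for `U1`-valued `V, V′` with `‖V(b) − V′(b)‖ ≤ ε` and `‖V(b)⁻¹ − V′(b)⁻¹‖ ≤ ε` on every bond,
`‖V(Γ) − V′(Γ)‖ ≤ |Γ|·ε` for every lattice word `Γ` (telescoping `ah − a′h′ = (a − a′)h + a′(h − h′)`, all factors of norm `≤ 1`). [cite: Balaban1985Averaging, (9) p.18] -/
theorem norm_holT_sub_holT_le {V V' : GaugeField P j 𝔸ˣ} (hV : ∀ b, V b ∈ U1 𝔸) (hV' : ∀ b, V' b ∈ U1 𝔸) {ε : ℝ}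
    (hε : ∀ b, ‖((V b : 𝔸ˣ) : 𝔸) - ((V' b : 𝔸ˣ) : 𝔸)‖ ≤ ε ∧ ‖(((V b)⁻¹ : 𝔸ˣ) : 𝔸) - (((V' b)⁻¹ : 𝔸ˣ) : 𝔸)‖ ≤ ε) :
    ∀ (x : Site P j) (w : List (Letter P.d)), ‖((holT V x w : 𝔸ˣ) : 𝔸) - ((holT V' x w : 𝔸ˣ) : 𝔸)‖ ≤ w.length * ε
  | x, [] => by simp
  | x, (μ, true) :: w => by
    rw [holT_cons_true, holT_cons_true, Units.val_mul, Units.val_mul, List.length_cons, Nat.cast_succ]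
    have ih := norm_holT_sub_holT_le hV hV' hε (x.shift μ) w
    have h := norm_mul_sub_mul_le_add (hε ⟨x, μ⟩).1 (mem_U1.mp (hV' ⟨x, μ⟩)).1 (norm_val_holT_le_one hV (x.shift μ) w) ih
    linarith
  | x, (μ, false) :: w => by
    rw [holT_cons_false, holT_cons_false, Units.val_mul, Units.val_mul, List.length_cons, Nat.cast_succ]
    have ih := norm_holT_sub_holT_le hV hV' hε (x.unshift μ) w
    have h := norm_mul_sub_mul_le_add (hε ⟨x.unshift μ, μ⟩).2 (mem_U1.mp (hV' ⟨x.unshift μ, μ⟩)).2 (norm_val_holT_le_one hV (x.unshift μ) w) ih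
    linarith

end Transport

/-! ## §2 The contour of (27) and the Lipschitz bound for its loop variable -/

section Contour

variable {P : Params} {j : ℕ}

/-- The contour of (27) has `|c₋ − y|₁ + 1 + |c₊ − y|₁` bonds. [cite: Balaban1985UV3, (27) p.263] -/
theorem length_contourT (y : Site P j) (c : PBond P j) :
    (contourT y c).length = l1 (rel y c.src) + 1 + l1 (rel y c.src + e c.dir) := by
  rw [contourT_eq, List.length_append, List.length_append, length_treeWord, length_revWord, length_treeWord, List.length_singleton]

/-- … hence at most `2|c₋ − y|₁ + 2`. [cite: Balaban1985UV3, (27) p.263] -/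
theorem length_contourT_le (y : Site P j) (c : PBond P j) : (contourT y c).length ≤ 2 * l1 (rel y c.src) + 2 := by
  rw [length_contourT]
  have h1 : l1 (rel y c.src + e c.dir) ≤ l1 (rel y c.src) + 1 := by
    have h := l1_add_le (rel y c.src) (e c.dir)
    have he : l1 (e c.dir : B7Prop1Explicit.Site P.d) = 1 := l1_vec (c.dir, true)
    omega
  omega

variable {𝔸 : Type*} [NormedRing 𝔸] [NormOneClass 𝔸] [NormedAlgebra ℂ 𝔸] [CompleteSpace 𝔸]

/-- ★ **THE (27) LOOP VARIABLE IS LIPSCHITZ IN THE FIELD, CONSTANT `(1 − ρ)⁻¹·|Γ_{y,c}|`**: for `U1`-valued `V, V′` with bondwise `‖V − V′‖, ‖V⁻¹ − V′⁻¹‖ ≤ ε` and both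
contour holonomies within `ρ < 1` of `1` (the disc of the series logarithm), `‖B27T V y c − B27T V′ y c‖ ≤ (1 − ρ)⁻¹·|contourT y c|·ε`.
[cite: Balaban1985UV3, (27)-(28) p.263; Balaban1985Averaging, p.25] -/
theorem norm_B27T_sub_B27T_le {V V' : GaugeField P j 𝔸ˣ} (hV : ∀ b, V b ∈ U1 𝔸) (hV' : ∀ b, V' b ∈ U1 𝔸) {ε : ℝ}
    (hε : ∀ b, ‖((V b : 𝔸ˣ) : 𝔸) - ((V' b : 𝔸ˣ) : 𝔸)‖ ≤ ε ∧ ‖(((V b)⁻¹ : 𝔸ˣ) : 𝔸) - (((V' b)⁻¹ : 𝔸ˣ) : 𝔸)‖ ≤ ε)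
    (y : Site P j) (c : PBond P j) {ρ : ℝ} (hρ : ρ < 1)
    (hh : ‖((holT V y (contourT y c) : 𝔸ˣ) : 𝔸) - 1‖ ≤ ρ) (hh' : ‖((holT V' y (contourT y c) : 𝔸ˣ) : 𝔸) - 1‖ ≤ ρ) :
    ‖B27T V y c - B27T V' y c‖ ≤ (1 - ρ)⁻¹ * (contourT y c).length * ε := by
  set g : 𝔸 := ((holT V y (contourT y c) : 𝔸ˣ) : 𝔸) with hg
  set g' : 𝔸 := ((holT V' y (contourT y c) : 𝔸ˣ) : 𝔸) with hg'
  have hgg' : ‖g - g'‖ ≤ (contourT y c).length * ε := norm_holT_sub_holT_le hV hV' hε y (contourT y c)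
  have hlog : ‖mlog g - mlog g'‖ ≤ (1 - ρ)⁻¹ * ‖g - g'‖ := by
    have h := norm_mlog_sub_mlog_sub_le hρ hh hh'
    have e : mlog g - mlog g' = (mlog g - mlog g' - (g - g')) + (g - g') := by abel
    rw [e]
    calc ‖mlog g - mlog g' - (g - g') + (g - g')‖ ≤ ‖mlog g - mlog g' - (g - g')‖ + ‖g - g'‖ := norm_add_le _ _
      _ ≤ ρ / (1 - ρ) * ‖g - g'‖ + ‖g - g'‖ := add_le_add h le_rfl
      _ = (1 - ρ)⁻¹ * ‖g - g'‖ := by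
          have h1 : (1 - ρ) ≠ 0 := by linarith
          field_simp
          ring
  have h1ρ : 0 ≤ (1 - ρ)⁻¹ := inv_nonneg.mpr (by linarith)
  calc ‖B27T V y c - B27T V' y c‖ = ‖(-Complex.I) • (mlog g - mlog g')‖ := by rw [B27T_eq, B27T_eq, smul_sub]
    _ = ‖mlog g - mlog g'‖ := by rw [norm_smul, norm_neg, Complex.norm_I, one_mul]
    _ ≤ (1 - ρ)⁻¹ * ‖g - g'‖ := hlog
    _ ≤ (1 - ρ)⁻¹ * ((contourT y c).length * ε) := mul_le_mul_of_nonneg_left hgg' h1ρ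
    _ = (1 - ρ)⁻¹ * (contourT y c).length * ε := by ring

/-- ★ **THE SAME WITH THE LEG DISTANCE DISPLAYED**: `‖B27T V y c − B27T V′ y c‖ ≤ (1 − ρ)⁻¹·(2|c₋ − y|₁ + 2)·ε` (`ε ≥ 0`) — the Lipschitz constant of the (27) loop variable
grows LINEARLY in the distance of the leg from the anchor, which is the `(1 + d(c))` of (44) p.267. [cite: Balaban1985UV3, (27)-(28) p.263, (44) p.267] -/
theorem norm_B27T_sub_B27T_le_l1 {V V' : GaugeField P j 𝔸ˣ} (hV : ∀ b, V b ∈ U1 𝔸) (hV' : ∀ b, V' b ∈ U1 𝔸) {ε : ℝ} (hε0 : 0 ≤ ε)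
    (hε : ∀ b, ‖((V b : 𝔸ˣ) : 𝔸) - ((V' b : 𝔸ˣ) : 𝔸)‖ ≤ ε ∧ ‖(((V b)⁻¹ : 𝔸ˣ) : 𝔸) - (((V' b)⁻¹ : 𝔸ˣ) : 𝔸)‖ ≤ ε)
    (y : Site P j) (c : PBond P j) {ρ : ℝ} (hρ : ρ < 1)
    (hh : ‖((holT V y (contourT y c) : 𝔸ˣ) : 𝔸) - 1‖ ≤ ρ) (hh' : ‖((holT V' y (contourT y c) : 𝔸ˣ) : 𝔸) - 1‖ ≤ ρ) :
    ‖B27T V y c - B27T V' y c‖ ≤ (1 - ρ)⁻¹ * (2 * l1 (rel y c.src) + 2) * ε := by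
  have h1ρ : 0 ≤ (1 - ρ)⁻¹ := inv_nonneg.mpr (by linarith)
  have hlen : ((contourT y c).length : ℝ) ≤ 2 * l1 (rel y c.src) + 2 := by exact_mod_cast length_contourT_le y c
  calc ‖B27T V y c - B27T V' y c‖ ≤ (1 - ρ)⁻¹ * (contourT y c).length * ε := norm_B27T_sub_B27T_le hV hV' hε y c hρ hh hh'
    _ ≤ (1 - ρ)⁻¹ * (2 * l1 (rel y c.src) + 2) * ε := by
        exact mul_le_mul_of_nonneg_right (mul_le_mul_of_nonneg_left hlen h1ρ) hε0

end Contour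

/-! ## §3 The reading for the cell's `SU(N)`-valued configurations -/

section SpecialUnitary

open scoped Matrix.Norms.L2Operator

variable {P : Params} {j : ℕ} {N : ℕ} [NeZero N]

omit [NeZero N] in
/-- The inverse bond variable of an `SU(N)` field read in `M_N(ℂ)ˣ` is the adjoint matrix. [folklore] -/
theorem val_inv_unitsField_toUField (U : GaugeField P j (Matrix.specialUnitaryGroup (Fin N) ℂ)) (b : PBond P j) :
    (((unitsField (toUField U) b)⁻¹ : (Matrix (Fin N) (Fin N) ℂ)ˣ) : Matrix (Fin N) (Fin N) ℂ) =
      star (((U b : Matrix.specialUnitaryGroup (Fin N) ℂ) : Matrix (Fin N) (Fin N) ℂ)) := by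
  apply Units.inv_eq_of_mul_eq_one_left
  exact Unitary.coe_star_mul_self (suIncl (U b))

omit [NeZero N] in
/-- For `SU(N)`-valued fields read in `M_N(ℂ)ˣ` the inverse bond variables are the adjoints, so ONE bondwise bound `‖U(b) − U′(b)‖ ≤ ε` gives both hypotheses of
`norm_holT_sub_holT_le`. [cite: Balaban1985Averaging, (19) p.21] -/
theorem norm_unitsField_sub_le (U U' : GaugeField P j (Matrix.specialUnitaryGroup (Fin N) ℂ)) {ε : ℝ}
    (hε : ∀ b, ‖((U b : Matrix.specialUnitaryGroup (Fin N) ℂ) : Matrix (Fin N) (Fin N) ℂ) - ((U' b : Matrix.specialUnitaryGroup (Fin N) ℂ) : Matrix (Fin N) (Fin N) ℂ)‖ ≤ ε)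
    (b : PBond P j) :
    ‖((unitsField (toUField U) b : (Matrix (Fin N) (Fin N) ℂ)ˣ) : Matrix (Fin N) (Fin N) ℂ) - ((unitsField (toUField U') b : (Matrix (Fin N) (Fin N) ℂ)ˣ) : _)‖ ≤ ε ∧
      ‖(((unitsField (toUField U) b)⁻¹ : (Matrix (Fin N) (Fin N) ℂ)ˣ) : Matrix (Fin N) (Fin N) ℂ) -
          (((unitsField (toUField U') b)⁻¹ : (Matrix (Fin N) (Fin N) ℂ)ˣ) : Matrix (Fin N) (Fin N) ℂ)‖ ≤ ε := by
  refine ⟨hε b, ?_⟩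
  rw [val_inv_unitsField_toUField, val_inv_unitsField_toUField, ← star_sub, norm_star]
  exact hε b

/-- ★ **THE (27) LOOP VARIABLES OF `SU(N)` FIELDS ARE LIPSCHITZ WITH CONSTANT `(1 − ρ)⁻¹·(2|c₋ − y|₁ + 2)`**: `‖B(U)(c) − B(U′)(c)‖ ≤ (1 − ρ)⁻¹·(2|c₋ − y|₁ + 2)·sup_b‖U(b) − U′(b)‖`
inside the disc of the logarithm. [cite: Balaban1985UV3, (27)-(28) p.263, (44) p.267] -/
theorem norm_B27T_su_sub_le (U U' : GaugeField P j (Matrix.specialUnitaryGroup (Fin N) ℂ)) {ε : ℝ} (hε0 : 0 ≤ ε)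
    (hε : ∀ b, ‖((U b : Matrix.specialUnitaryGroup (Fin N) ℂ) : Matrix (Fin N) (Fin N) ℂ) - ((U' b : Matrix.specialUnitaryGroup (Fin N) ℂ) : Matrix (Fin N) (Fin N) ℂ)‖ ≤ ε)
    (y : Site P j) (c : PBond P j) {ρ : ℝ} (hρ : ρ < 1)
    (hh : ‖((holT (unitsField (toUField U)) y (contourT y c) : (Matrix (Fin N) (Fin N) ℂ)ˣ) : Matrix (Fin N) (Fin N) ℂ) - 1‖ ≤ ρ)
    (hh' : ‖((holT (unitsField (toUField U')) y (contourT y c) : (Matrix (Fin N) (Fin N) ℂ)ˣ) : Matrix (Fin N) (Fin N) ℂ) - 1‖ ≤ ρ) :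
    ‖B27T (unitsField (toUField U)) y c - B27T (unitsField (toUField U')) y c‖ ≤ (1 - ρ)⁻¹ * (2 * l1 (rel y c.src) + 2) * ε := by
  letI : CStarAlgebra (Matrix (Fin N) (Fin N) ℂ) := B10Eq29TubeLine.cstarAlgebraMatrix N
  have hU : ∀ b, unitsField (toUField U) b ∈ U1 (Matrix (Fin N) (Fin N) ℂ) := U1_of_unitaryUnits (unitsField_mem_unitaryUnits (toUField U))
  have hU' : ∀ b, unitsField (toUField U') b ∈ U1 (Matrix (Fin N) (Fin N) ℂ) := U1_of_unitaryUnits (unitsField_mem_unitaryUnits (toUField U'))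
  exact norm_B27T_sub_B27T_le_l1 hU hU' hε0 (norm_unitsField_sub_le U U' hε) y c hρ hh hh'

end SpecialUnitary

/-! ## §4 The bridge to the canonical leg distance of 3⁗χ -/

section Bridge

open scoped Matrix.Norms.L2Operator

variable {F : T3Family}

/-- ★ **AT AN ANCHOR ATTAINING THE CANONICAL LEG DISTANCE the (27) loop variables of two `SU(2)` fields differ by at most `2(1 − ρ)⁻¹·(1 + canonLegDist F K b Y c)·ε`** — the
display (Lip)/(C) of `…KernelLegCfgFixedPoint*` for the natural configuration family, with exactly the row's weight `1 + d(c)`. [cite: Balaban1985UV3, (27) p.263, (44) p.267] -/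
theorem norm_B27T_su_sub_le_canonLegDist {K b : ℕ} (Y : Set (Site (F.P K) 0)) (c : PBond (F.P K) b) {y : Site (F.P K) b}
    (hy : canonLegDist F K b Y c = pdist c.src y) (U U' : GaugeField (F.P K) b (Matrix.specialUnitaryGroup (Fin 2) ℂ)) {ε : ℝ} (hε0 : 0 ≤ ε)
    (hε : ∀ b', ‖((U b' : Matrix.specialUnitaryGroup (Fin 2) ℂ) : Matrix (Fin 2) (Fin 2) ℂ) - ((U' b' : Matrix.specialUnitaryGroup (Fin 2) ℂ) : Matrix (Fin 2) (Fin 2) ℂ)‖ ≤ ε)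
    {ρ : ℝ} (hρ : ρ < 1)
    (hh : ‖((holT (unitsField (toUField U)) y (contourT y c) : (Matrix (Fin 2) (Fin 2) ℂ)ˣ) : Matrix (Fin 2) (Fin 2) ℂ) - 1‖ ≤ ρ)
    (hh' : ‖((holT (unitsField (toUField U')) y (contourT y c) : (Matrix (Fin 2) (Fin 2) ℂ)ˣ) : Matrix (Fin 2) (Fin 2) ℂ) - 1‖ ≤ ρ) :
    ‖B27T (unitsField (toUField U)) y c - B27T (unitsField (toUField U')) y c‖ ≤ 2 * (1 - ρ)⁻¹ * (1 + canonLegDist F K b Y c) * ε := by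
  have h := norm_B27T_su_sub_le U U' hε0 hε y c hρ hh hh'
  rw [cast_l1_rel_eq_pdist, ← hy] at h
  calc _ ≤ (1 - ρ)⁻¹ * (2 * canonLegDist F K b Y c + 2) * ε := h
    _ = 2 * (1 - ρ)⁻¹ * (1 + canonLegDist F K b Y c) * ε := by ring

/-- An anchor attaining the canonical leg distance exists (`exists_canonLegDist_eq`), so the bound above is available at every leg. [folklore] -/
theorem exists_anchor_norm_B27T_su_sub_le {K b : ℕ} (Y : Set (Site (F.P K) 0)) (c : PBond (F.P K) b)
    (U U' : GaugeField (F.P K) b (Matrix.specialUnitaryGroup (Fin 2) ℂ)) {ε : ℝ} (hε0 : 0 ≤ ε)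
    (hε : ∀ b', ‖((U b' : Matrix.specialUnitaryGroup (Fin 2) ℂ) : Matrix (Fin 2) (Fin 2) ℂ) - ((U' b' : Matrix.specialUnitaryGroup (Fin 2) ℂ) : Matrix (Fin 2) (Fin 2) ℂ)‖ ≤ ε)
    {ρ : ℝ} (hρ : ρ < 1)
    (hh : ∀ y ∈ anchors K b Y, ‖((holT (unitsField (toUField U)) y (contourT y c) : (Matrix (Fin 2) (Fin 2) ℂ)ˣ) : Matrix (Fin 2) (Fin 2) ℂ) - 1‖ ≤ ρ ∧
      ‖((holT (unitsField (toUField U')) y (contourT y c) : (Matrix (Fin 2) (Fin 2) ℂ)ˣ) : Matrix (Fin 2) (Fin 2) ℂ) - 1‖ ≤ ρ) :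
    ∃ y ∈ anchors K b Y, canonLegDist F K b Y c = pdist c.src y ∧
      ‖B27T (unitsField (toUField U)) y c - B27T (unitsField (toUField U')) y c‖ ≤ 2 * (1 - ρ)⁻¹ * (1 + canonLegDist F K b Y c) * ε := by
  obtain ⟨y, hy, hyeq⟩ := exists_canonLegDist_eq K b Y c
  exact ⟨y, hy, hyeq, norm_B27T_su_sub_le_canonLegDist Y c hyeq U U' hε0 hε hρ (hh y hy).1 (hh y hy).2⟩

end Bridge

end Summit.QuantumFields.YangMills.Theorems.GlobalSlackKernelLeg

end
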